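import Mathlib
import HarnessLib
import Summits.HubbardSuperconductivity.HubbardSuperconductivity.Theorems.WeakCouplingBCSKlLindhardEnclosureTipMeanValue
import Summits.HubbardSuperconductivity.HubbardSuperconductivity.Theorems.WeakCouplingBCSKlLindhardEnclosureTipSlices
import Summits.HubbardSuperconductivity.HubbardSuperconductivity.Theorems.WeakCouplingBCSKlLindhardEnclosureCeilRulesOrd
import Summits.HubbardSuperconductivity.HubbardSuperconductivity.Theorems.WeakCouplingBCSKlLindhardEnclosureLogBounds

/-!
# KL-MARGIN-SCAN reader (22) «kernel-lindhard-enclosure» — THE TIP RULE IS SOUND: `ceilTipSoundOrd : ∀ P, CeilTipSoundOrd P` (seat p4 g25)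

Assembly of the tip rule's soundness from the generic layers (`…TipCore`, `…TipMeanValue`, `…TipBox`), the records layer (`…TipRecords`,
p1 g26's `…BdryRecords/2`) and the cell layer (`…TipSlices`):

* §1 `Params.tip_ceilValid_of_box` — a real box bound on `[a/U,b/U]×[c/U,d/U]` for `F ∘ pt` transfers to `CeilValid a b c d w` once `2^30·R ≤ w`
  (measure-preserving `p ↦ (p 0, p 1)`, `cellSet ⊆` the closed box);
* §2 `tip_rounding` — the kernel integer `tipVariant v m dz (logUpZ Z₁ + D)` dominates `2^30 ×` the real bound of `tip_box_bound` (`le_logUpZ`, `cdivZ`);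
* §3 the four variants `Params.tip_variant₁…₄_valid` (outer `x`/`y` × monotone `e₁`/`e₂`), each = `tip_box_bound(_swap)` on the cell data of `…TipSlices`
  with `κ = J₀/(2·Lmax)` from `sum_abs_ge_of_isMinOn` at the minimiser of `|e₁| + |e₂|` on the closed cell;
* §4 **`ceilTipSoundOrd`** — unpacking `Params.ceilTip … = some u` (four certified directions, hints ∧ guards, `0 < J0`, `u = min` of the available
  variants) ⇒ `P.CeilValid a b c d u`.

With p1 g26's `ceilChordSoundOrd`/`floorInsideSoundOrd` and the boundary rules, this is one of the three curved-cell rules of `sound_of_five_rulesOrd`.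
Honest framing: instrument soundness only; `W20_enclosure` stays conditional on the remaining rules; nothing here asserts a margin at `t′ ≠ 0`, a channel
order, `K₃`, `U₀`, the window or superconductivity; a Kohn–Luttinger `O(U²)` channel statement is not ODLRO.
References: idea-4 r11 Core §3b/§5 (tree: `…LindhardEnclosureKernel`, `…LindhardEnclosureGate`).
-/

noncomputable section

set_option linter.dupNamespace false

namespace Summit.HubbardSuperconductivity.HubbardSuperconductivity.Theorems.KlLindhardEnclosure

open Real Set MeasureTheory Literature.MathematicalPhysics.QuantumLattice
open scoped ENNReal

/-! ## §1 From a real box bound to `CeilValid` -/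

/-- `pt (p 0) (p 1) = p`. [folklore] -/
theorem pt_coord (p : Momentum) : pt (p 0) (p 1) = p := by
  ext i
  fin_cases i
  · exact pt_apply_zero _ _
  · exact pt_apply_one _ _

/-- The coordinate map `p ↦ (p 0, p 1)` as a composite of the tree's measurable equivalences. [folklore] -/
theorem coordMap_eq (p : Momentum) :
    (MeasurableEquiv.finTwoArrow (α := ℝ)) ((WithLp.ofLp : Momentum → (Fin 2 → ℝ)) p) = (p 0, p 1) := by
  simp [MeasurableEquiv.finTwoArrow, MeasurableEquiv.piFinTwo]

/-- **Transfer**: if `(x, y) ↦ F(pt x y)` (`F = P.integrand`) is integrable on the CLOSED box `[a/U,b/U] × [c/U,d/U]` with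
integral `≤ R` and `2^30·R ≤ w`, then `P.CeilValid a b c d w`. [folklore] -/
theorem Params.tip_ceilValid_of_box (P : Params) {a b c d w : ℤ} {R : ℝ}
    (hint : IntegrableOn (Function.uncurry fun x y => P.integrand (pt x y))
      (Icc ((a : ℝ) / (P.U : ℝ)) ((b : ℝ) / (P.U : ℝ)) ×ˢ Icc ((c : ℝ) / (P.U : ℝ)) ((d : ℝ) / (P.U : ℝ))) volume)
    (hle : ∫ z in Icc ((a : ℝ) / (P.U : ℝ)) ((b : ℝ) / (P.U : ℝ)) ×ˢ Icc ((c : ℝ) / (P.U : ℝ)) ((d : ℝ) / (P.U : ℝ)),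
      (Function.uncurry fun x y => P.integrand (pt x y)) z ≤ R)
    (hw : 2 ^ 30 * R ≤ (w : ℝ)) : P.CeilValid a b c d w := by
  set ra := (a : ℝ) / (P.U : ℝ)
  set rb := (b : ℝ) / (P.U : ℝ)
  set rc := (c : ℝ) / (P.U : ℝ)
  set rd := (d : ℝ) / (P.U : ℝ)
  set Φ : Momentum → ℝ × ℝ := fun p => (MeasurableEquiv.finTwoArrow (α := ℝ)) ((WithLp.ofLp : Momentum → (Fin 2 → ℝ)) p) with hΦdef
  have hΦmp : MeasurePreserving Φ volume volume :=
    (volume_preserving_finTwoArrow ℝ).comp (PiLp.volume_preserving_ofLp (Fin 2))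
  have hΦemb : MeasurableEmbedding Φ :=
    (MeasurableEquiv.finTwoArrow (α := ℝ)).measurableEmbedding.comp (MeasurableEquiv.toLp 2 (Fin 2 → ℝ)).symm.measurableEmbedding
  set G : ℝ × ℝ → ℝ := Function.uncurry fun x y => P.integrand (pt x y) with hGdef
  have hGΦ : G ∘ Φ = P.integrand := by
    funext p
    simp only [Function.comp_apply, hΦdef, coordMap_eq, hGdef, Function.uncurry_apply_pair, pt_coord]
  have hcell : P.cellSet a b c d = Φ ⁻¹' (Ico ra rb ×ˢ Ico rc rd) := by
    rw [P.cellSet_eq_preimage, P.box_eq_preimage_prod, P.cast_toQ, P.cast_toQ, P.cast_toQ, P.cast_toQ]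
    rfl
  have hsub : Ico ra rb ×ˢ Ico rc rd ⊆ Icc ra rb ×ˢ Icc rc rd := prod_mono Ico_subset_Icc_self Ico_subset_Icc_self
  have hintIco : IntegrableOn G (Ico ra rb ×ˢ Ico rc rd) volume := hint.mono_set hsub
  have hint' : IntegrableOn P.integrand (P.cellSet a b c d) volume := by
    rw [hcell, ← hGΦ]
    exact (hΦmp.integrableOn_comp_preimage hΦemb).2 hintIco
  refine ⟨hint', ?_⟩
  have hval : P.cellInt a b c d = ∫ z in Ico ra rb ×ˢ Ico rc rd, G z := by
    unfold Params.cellInt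
    rw [hcell, ← hGΦ]
    exact hΦmp.setIntegral_preimage_emb hΦemb G _
  have hmono : ∫ z in Ico ra rb ×ˢ Ico rc rd, G z ≤ ∫ z in Icc ra rb ×ˢ Icc rc rd, G z :=
    setIntegral_mono_set hint (ae_of_all _ fun z => P.integrand_nonneg _) (ae_of_all _ hsub)
  rw [hval]
  linarith

/-! ## §2 The kernel integer dominates the real bound -/

/-- **Rounding**: for integers `v > 0`, `m ≥ 0`, `dz > 0`, `U > 0`, `J0 > 0`, `Lmax > 0`, `Uk ≥ 0`, with `cD = 10⁴·2^40`, `v_r = v/cD`, `m_r = m/cD`,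
`κ_r = J0/(2·cD·Lmax)`, `U_r = Uk/2^40`, `h = dz/U`:
`2^30·(2(1 + m_r/v_r)/v_r)·h·(log(1 + 2U_r/(κ_r h)) + 1) ≤ cdivZ (2^31 (v+m) 10⁴ dz (logUpZ Z + D)) (v² U)`, `Z = cdivZ (4 Uk Lmax U 10⁴ D) (J0 dz)`.
[folklore] -/
theorem tip_rounding {v m dz U J0 Lmax Uk : ℤ} (hv : 0 < v) (hm : 0 ≤ m) (hdz : 0 < dz) (hU : 0 < U) (hJ : 0 < J0) (hL : 0 < Lmax)
    (hUk : 0 ≤ Uk) :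
    2 ^ 30 * (2 * (1 + ((m : ℝ) / (10 ^ 4 * 2 ^ 40)) / ((v : ℝ) / (10 ^ 4 * 2 ^ 40))) / ((v : ℝ) / (10 ^ 4 * 2 ^ 40)) *
        ((dz : ℝ) / (U : ℝ)) *
        (Real.log (1 + 2 * ((Uk : ℝ) / 2 ^ 40) / ((J0 : ℝ) / (2 * (10 ^ 4 * 2 ^ 40) * (Lmax : ℝ)) * ((dz : ℝ) / (U : ℝ)))) + 1)) ≤
      ((cdivZ (2 ^ 31 * (v + m) * 10 ^ 4 * dz * (logUpZ (cdivZ (4 * Uk * Lmax * U * 10 ^ 4 * D) (J0 * dz)) + D)) (v ^ 2 * U) : ℤ) : ℝ) := by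
  have hv' : (0 : ℝ) < (v : ℝ) := by exact_mod_cast hv
  have hm' : (0 : ℝ) ≤ (m : ℝ) := by exact_mod_cast hm
  have hdz' : (0 : ℝ) < (dz : ℝ) := by exact_mod_cast hdz
  have hU' : (0 : ℝ) < (U : ℝ) := by exact_mod_cast hU
  have hJ' : (0 : ℝ) < (J0 : ℝ) := by exact_mod_cast hJ
  have hL' : (0 : ℝ) < (Lmax : ℝ) := by exact_mod_cast hL
  have hUk' : (0 : ℝ) ≤ (Uk : ℝ) := by exact_mod_cast hUk
  set Z : ℤ := cdivZ (4 * Uk * Lmax * U * 10 ^ 4 * D) (J0 * dz) with hZdef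
  -- Z ≥ the real quotient ≥ 0
  have hZge : (4 * (Uk : ℝ) * (Lmax : ℝ) * (U : ℝ) * 10 ^ 4 * 2 ^ 40) / ((J0 : ℝ) * (dz : ℝ)) ≤ (Z : ℝ) := by
    have h := div_le_cdivZ_real (4 * Uk * Lmax * U * 10 ^ 4 * D) (J0 * dz) (mul_pos hJ hdz)
    rw [hZdef]
    have e1 : (((4 * Uk * Lmax * U * 10 ^ 4 * D : ℤ) : ℝ)) = 4 * (Uk : ℝ) * (Lmax : ℝ) * (U : ℝ) * 10 ^ 4 * 2 ^ 40 := by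
      push_cast; rw [cast_D_real]; norm_num
    have e2 : (((J0 * dz : ℤ) : ℝ)) = (J0 : ℝ) * (dz : ℝ) := by push_cast; ring
    rw [e1, e2] at h
    exact h
  have hZ0 : 0 ≤ Z := by
    have : (0 : ℝ) ≤ (Z : ℝ) := le_trans (by positivity) hZge
    exact_mod_cast this
  have hlogUp := le_logUpZ hZ0
  -- the log argument equals 4 Uk Lmax U 10⁴ /(J0 dz) ≤ Z / 2^40
  have harg : 2 * ((Uk : ℝ) / 2 ^ 40) / ((J0 : ℝ) / (2 * (10 ^ 4 * 2 ^ 40) * (Lmax : ℝ)) * ((dz : ℝ) / (U : ℝ))) =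
      (4 * (Uk : ℝ) * (Lmax : ℝ) * (U : ℝ) * 10 ^ 4 * 2 ^ 40) / ((J0 : ℝ) * (dz : ℝ)) / 2 ^ 40 := by
    field_simp
    ring
  have hlog : Real.log (1 + 2 * ((Uk : ℝ) / 2 ^ 40) / ((J0 : ℝ) / (2 * (10 ^ 4 * 2 ^ 40) * (Lmax : ℝ)) * ((dz : ℝ) / (U : ℝ)))) ≤
      Real.log (1 + (Z : ℝ) / 2 ^ 40) := by
    rw [harg]
    refine Real.log_le_log (by positivity) ?_
    have := div_le_div_of_nonneg_right hZge (by positivity : (0 : ℝ) ≤ 2 ^ 40)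
    linarith
  -- prefactor identity
  have hpre : 2 ^ 30 * (2 * (1 + ((m : ℝ) / (10 ^ 4 * 2 ^ 40)) / ((v : ℝ) / (10 ^ 4 * 2 ^ 40))) / ((v : ℝ) / (10 ^ 4 * 2 ^ 40)) *
      ((dz : ℝ) / (U : ℝ))) = (2 ^ 31 * ((v : ℝ) + (m : ℝ)) * 10 ^ 4 * (dz : ℝ)) / ((v : ℝ) ^ 2 * (U : ℝ)) * 2 ^ 40 := by
    field_simp
  -- the kernel integer
  have hw := div_le_cdivZ_real (2 ^ 31 * (v + m) * 10 ^ 4 * dz * (logUpZ Z + D)) (v ^ 2 * U) (by positivity)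
  have e3 : ((2 ^ 31 * (v + m) * 10 ^ 4 * dz * (logUpZ Z + D) : ℤ) : ℝ) =
      2 ^ 31 * ((v : ℝ) + (m : ℝ)) * 10 ^ 4 * (dz : ℝ) * (((logUpZ Z : ℤ) : ℝ) + 2 ^ 40) := by
    push_cast; rw [cast_D_real]; norm_num
  have e4 : ((v ^ 2 * U : ℤ) : ℝ) = (v : ℝ) ^ 2 * (U : ℝ) := by push_cast; ring
  rw [e3, e4] at hw
  have hK : 0 ≤ (2 ^ 31 * ((v : ℝ) + (m : ℝ)) * 10 ^ 4 * (dz : ℝ)) / ((v : ℝ) ^ 2 * (U : ℝ)) := by positivity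
  have hZr : (0 : ℝ) ≤ (Z : ℝ) / 2 ^ 40 := by positivity
  have hlog0 : 0 ≤ Real.log (1 + (Z : ℝ) / 2 ^ 40) := Real.log_nonneg (by linarith)
  set Lg : ℝ := Real.log (1 + 2 * ((Uk : ℝ) / 2 ^ 40) / ((J0 : ℝ) / (2 * (10 ^ 4 * 2 ^ 40) * (Lmax : ℝ)) * ((dz : ℝ) / (U : ℝ)))) with hLg
  calc 2 ^ 30 * (2 * (1 + ((m : ℝ) / (10 ^ 4 * 2 ^ 40)) / ((v : ℝ) / (10 ^ 4 * 2 ^ 40))) / ((v : ℝ) / (10 ^ 4 * 2 ^ 40)) *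
        ((dz : ℝ) / (U : ℝ)) * (Lg + 1))
      = (2 ^ 30 * (2 * (1 + ((m : ℝ) / (10 ^ 4 * 2 ^ 40)) / ((v : ℝ) / (10 ^ 4 * 2 ^ 40))) / ((v : ℝ) / (10 ^ 4 * 2 ^ 40)) *
        ((dz : ℝ) / (U : ℝ)))) * (Lg + 1) := by ring
    _ = (2 ^ 31 * ((v : ℝ) + (m : ℝ)) * 10 ^ 4 * (dz : ℝ)) / ((v : ℝ) ^ 2 * (U : ℝ)) * 2 ^ 40 * (Lg + 1) := by rw [hpre]
    _ = (2 ^ 31 * ((v : ℝ) + (m : ℝ)) * 10 ^ 4 * (dz : ℝ)) / ((v : ℝ) ^ 2 * (U : ℝ)) * (2 ^ 40 * Lg + 2 ^ 40) := by ring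
    _ ≤ (2 ^ 31 * ((v : ℝ) + (m : ℝ)) * 10 ^ 4 * (dz : ℝ)) / ((v : ℝ) ^ 2 * (U : ℝ)) * (2 ^ 40 * Real.log (1 + (Z : ℝ) / 2 ^ 40) + 2 ^ 40) := by
        gcongr
    _ ≤ (2 ^ 31 * ((v : ℝ) + (m : ℝ)) * 10 ^ 4 * (dz : ℝ)) / ((v : ℝ) ^ 2 * (U : ℝ)) * ((((logUpZ Z : ℤ) : ℝ)) + 2 ^ 40) := by
        gcongr
    _ = 2 ^ 31 * ((v : ℝ) + (m : ℝ)) * 10 ^ 4 * (dz : ℝ) * ((((logUpZ Z : ℤ) : ℝ)) + 2 ^ 40) / ((v : ℝ) ^ 2 * (U : ℝ)) := by ring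
    _ ≤ _ := hw

/-! ## §3 The cell package and the four variants -/

/-- `0 < absLo a` splits into the two strict cases. [folklore] -/
theorem IV.absLo_pos_cases (a : IV) (h : 0 < a.absLo) : (0 < a.lo ∧ a.absLo = a.lo) ∨ (a.hi < 0 ∧ a.absLo = -a.hi) := by
  unfold IV.absLo at *
  split_ifs at h ⊢ with h1 h2
  · exact Or.inl ⟨h1, rfl⟩
  · exact Or.inr ⟨h2, rfl⟩
  · exact absurd h (lt_irrefl 0)

/-- `Lmax = 2·10⁴·(D + ⌈2|tpN|D/tpD⌉) > 0` (`tpD > 0`). [folklore] -/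
theorem Params.Lmax_pos (P : Params) (htpD : 0 < P.tpD) : 0 < 2 * 10 ^ 4 * (D + cdivZ (2 * |P.tpN| * D) P.tpD) := by
  have hc := div_le_cdivZ_real (2 * |P.tpN| * D) P.tpD htpD
  have h0 : (0 : ℝ) ≤ ((2 * |P.tpN| * D : ℤ) : ℝ) / (P.tpD : ℝ) := by
    apply div_nonneg _ (by exact_mod_cast htpD.le)
    have : (0 : ℤ) ≤ 2 * |P.tpN| * D := by have := abs_nonneg P.tpN; unfold D; positivity
    exact_mod_cast this
  have h1 : (0 : ℤ) ≤ cdivZ (2 * |P.tpN| * D) P.tpD := by exact_mod_cast h0.trans hc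
  unfold D at h1 ⊢
  omega

/-- A degenerate cell (`c = d` or `a = b`) has an empty `cellSet`, so every `w ≥ 0` is a valid ceiling. [folklore] -/
theorem Params.ceilValid_of_degenerate (P : Params) {a b c d w : ℤ} (h : a = b ∨ c = d) (hw : (0 : ℝ) ≤ (w : ℝ)) : P.CeilValid a b c d w := by
  have hempty : P.cellSet a b c d = ∅ := by
    ext p
    simp only [Params.cellSet, mem_setOf_eq, mem_empty_iff_false, iff_false, not_and, not_lt]
    intro h1 h2 h3
    rcases h with h | h
    · subst h; exact absurd h2 (not_lt.2 h1)
    · subst h; exact h3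
  refine ⟨by rw [hempty]; exact integrableOn_empty, ?_⟩
  unfold Params.cellInt
  rw [hempty, Measure.restrict_empty, integral_zero_measure]
  simpa using hw

section Variants

variable (P : Params) {a b c d : ℤ}

/-- **The scaled determinant bound from the interval boxes**: entries in `X1, Y1, X2, Y2` ⇒ `J0 ≤ |A·D′ − B·C′|`, `J0 = absLo((X1·Y2) − (Y1·X2))`. [folklore] -/
theorem det_ge_J0 (X1 Y1 X2 Y2 : IV) {A B C' D' : ℝ}
    (hA1 : (X1.lo : ℝ) ≤ A) (hA2 : A ≤ (X1.hi : ℝ)) (hB1 : (Y1.lo : ℝ) ≤ B) (hB2 : B ≤ (Y1.hi : ℝ))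
    (hC1 : (X2.lo : ℝ) ≤ C') (hC2 : C' ≤ (X2.hi : ℝ)) (hD1 : (Y2.lo : ℝ) ≤ D') (hD2 : D' ≤ (Y2.hi : ℝ)) :
    ((((X1.mul Y2).sub (Y1.mul X2)).absLo : ℤ) : ℝ) ≤ |A * D' - B * C'| := by
  obtain ⟨p1, p2⟩ := IV.mul_sound X1 Y2 hA1 hA2 hD1 hD2
  obtain ⟨q1, q2⟩ := IV.mul_sound Y1 X2 hB1 hB2 hC1 hC2
  obtain ⟨r1, r2⟩ := IV.sub_sound (X1.mul Y2) (Y1.mul X2) p1 p2 q1 q2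
  exact IV.absLo_sound _ r1 r2

/-- Unscaling the determinant: `J0 ≤ |(cA)(cD′) − (cB)(cC′)| ⇒ J0/c² ≤ |A D′ − B C′|` (`c = 10⁴·2^40`). [folklore] -/
theorem det_unscale {J0 A B C' D' : ℝ} (h : J0 ≤ |(10 ^ 4 * 2 ^ 40 * A) * (10 ^ 4 * 2 ^ 40 * D') - (10 ^ 4 * 2 ^ 40 * B) * (10 ^ 4 * 2 ^ 40 * C')|) :
    J0 / (10 ^ 4 * 2 ^ 40) ^ 2 ≤ |A * D' - B * C'| := by
  rw [div_le_iff₀ (by positivity)]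
  have e : (10 ^ 4 * 2 ^ 40 * A) * (10 ^ 4 * 2 ^ 40 * D') - (10 ^ 4 * 2 ^ 40 * B) * (10 ^ 4 * 2 ^ 40 * C') =
      (A * D' - B * C') * ((10 : ℝ) ^ 4 * 2 ^ 40) ^ 2 := by ring
  rw [e, abs_mul, abs_of_pos (by positivity : (0:ℝ) < ((10 : ℝ) ^ 4 * 2 ^ 40) ^ 2)] at h
  exact h

/-- Unscaling an enclosure: `lo ≤ c·z ≤ hi ⇒ |z| ≤ (max |lo| |hi|)/c` and the one-sided forms. [folklore] -/
theorem abs_le_of_scaled (I : IV) {z : ℝ} (h1 : (I.lo : ℝ) ≤ 10 ^ 4 * 2 ^ 40 * z) (h2 : 10 ^ 4 * 2 ^ 40 * z ≤ (I.hi : ℝ)) :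
    |z| ≤ ((max |I.lo| |I.hi| : ℤ) : ℝ) / (10 ^ 4 * 2 ^ 40) := by
  rw [le_div_iff₀ (by positivity), ← abs_of_pos (by positivity : (0:ℝ) < 10 ^ 4 * 2 ^ 40), ← abs_mul, mul_comm]
  exact IV.abs_le_max I h1 h2

/-- Unscaling against `Lmax`: `c·|z| ≤ L ⇒ |z| ≤ L/c`. [folklore] -/
theorem abs_le_Lmax_unscale {z L : ℝ} (h : (10 : ℝ) ^ 4 * 2 ^ 40 * |z| ≤ L) : |z| ≤ L / (10 ^ 4 * 2 ^ 40) := by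
  rw [le_div_iff₀ (by positivity), mul_comm]; exact h

/-- **THE CELL PACKAGE (cross-slice lower bound)**: on a guarded oriented in-root cell with four certified cosine directions, checked hints and
`0 < J0`, there is a point `(x′, y′)` of the closed cell with `(J0/c²)/(2·Lmax/c)·max(|x − x′|, |y − y′|) ≤ |ε_p − μ| + |ε_{p+q} − μ|`
everywhere on the closed cell (`c = 10⁴·2^40`; `sum_abs_ge_of_isMinOn` at the minimiser of `|ε_p − μ| + |ε_{p+q} − μ|`). [folklore] -/
theorem Params.tip_cell_package (hP : P.admissible = true) (hin : P.InRoot a b c d) (hab : a ≤ b) (hcd : c ≤ d) (C : Cell)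
    (hC : C = P.cell (P.mkX a) (P.mkX b) (P.mkY c) (P.mkY d)) (hg : C.guards = true) {dx dy dx' dy' : Bool}
    (hdx : P.cosDirZ a b = some dx) (hdy : P.cosDirZ c d = some dy) (hdx' : P.cosDirZ (a + P.q1z) (b + P.q1z) = some dx')
    (hdy' : P.cosDirZ (c + P.q2z) (d + P.q2z) = some dy') {τx σx τy σy τx' σx' τy' σy' : ℕ}
    (h1 : sinLoOK C.aLo C.aUp τx = true) (h2 : sinHiOK C.aLo C.aUp σx = true) (h3 : sinLoOK C.bLo C.bUp τy = true)
    (h4 : sinHiOK C.bLo C.bUp σy = true) (h5 : sinLoOK C.aLo' C.aUp' τx' = true) (h6 : sinHiOK C.aLo' C.aUp' σx' = true)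
    (h7 : sinLoOK C.bLo' C.bUp' τy' = true) (h8 : sinHiOK C.bLo' C.bUp' σy' = true) :
    ∃ x' ∈ Icc ((a : ℝ) / (P.U : ℝ)) ((b : ℝ) / (P.U : ℝ)), ∃ y' ∈ Icc ((c : ℝ) / (P.U : ℝ)) ((d : ℝ) / (P.U : ℝ)),
      ∀ x ∈ Icc ((a : ℝ) / (P.U : ℝ)) ((b : ℝ) / (P.U : ℝ)), ∀ y ∈ Icc ((c : ℝ) / (P.U : ℝ)) ((d : ℝ) / (P.U : ℝ)),
        ((((((P.derivIV dx τx σx C.bLo C.bUp).mul (P.derivIV dy' τy' σy' C.aLo' C.aUp')).sub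
            ((P.derivIV dy τy σy C.aLo C.aUp).mul (P.derivIV dx' τx' σx' C.bLo' C.bUp'))).absLo : ℤ) : ℝ) / (10 ^ 4 * 2 ^ 40) ^ 2) /
            (2 * ((((2 * 10 ^ 4 * (D + cdivZ (2 * |P.tpN| * D) P.tpD)) : ℤ) : ℝ) / (10 ^ 4 * 2 ^ 40))) *
          max |x - x'| |y - y'| ≤
        |P.band (pt x y) - (P.muN : ℝ) / (P.muD : ℝ)| + |P.band (pt x y + P.qv) - (P.muN : ℝ) / (P.muD : ℝ)| := by
  obtain ⟨htpD, -, hU, -, -⟩ := P.admissible_facts hP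
  have hU' : (0 : ℝ) < (P.U : ℝ) := by exact_mod_cast hU
  have hab' : (a : ℝ) / (P.U : ℝ) ≤ (b : ℝ) / (P.U : ℝ) := div_le_div_of_nonneg_right (by exact_mod_cast hab) hU'.le
  have hcd' : (c : ℝ) / (P.U : ℝ) ≤ (d : ℝ) / (P.U : ℝ) := div_le_div_of_nonneg_right (by exact_mod_cast hcd) hU'.le
  -- explicit energies and partials
  set f : ℝ → ℝ → ℝ := fun x y => -2 * (Real.cos (x + 0) + Real.cos (y + 0)) - 4 * ((P.tpN : ℝ) / (P.tpD : ℝ)) * Real.cos (x + 0) * Real.cos (y + 0) - ((P.muN : ℝ) / (P.muD : ℝ)) with hf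
  set g : ℝ → ℝ → ℝ := fun x y => -2 * (Real.cos (x + ((P.q1z : ℝ) / (P.U : ℝ))) + Real.cos (y + ((P.q2z : ℝ) / (P.U : ℝ)))) - 4 * ((P.tpN : ℝ) / (P.tpD : ℝ)) * Real.cos (x + ((P.q1z : ℝ) / (P.U : ℝ))) * Real.cos (y + ((P.q2z : ℝ) / (P.U : ℝ))) - ((P.muN : ℝ) / (P.muD : ℝ)) with hgd
  have hfe : ∀ x y, f x y = P.band (pt x y) - ((P.muN : ℝ) / (P.muD : ℝ)) := fun x y => by
    rw [P.tip_band_pt]; simp only [hf, add_zero]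
  have hge : ∀ x y, g x y = P.band (pt x y + P.qv) - ((P.muN : ℝ) / (P.muD : ℝ)) := fun x y => by rw [hgd, P.tip_band_pt_shift]
  have hfx : ∀ x y, HasDerivAt (fun s => f s y) (2 * Real.sin (x + 0) * (1 + 2 * ((P.tpN : ℝ) / (P.tpD : ℝ)) * Real.cos (y + 0))) x :=
    fun x y => hasDerivAt_bandFun_fst ((P.tpN : ℝ) / (P.tpD : ℝ)) ((P.muN : ℝ) / (P.muD : ℝ)) 0 0 y x
  have hfy : ∀ x y, HasDerivAt (fun s => f x s) (2 * Real.sin (y + 0) * (1 + 2 * ((P.tpN : ℝ) / (P.tpD : ℝ)) * Real.cos (x + 0))) y :=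
    fun x y => hasDerivAt_bandFun_snd ((P.tpN : ℝ) / (P.tpD : ℝ)) ((P.muN : ℝ) / (P.muD : ℝ)) 0 0 x y
  have hgx : ∀ x y, HasDerivAt (fun s => g s y) (2 * Real.sin (x + ((P.q1z : ℝ) / (P.U : ℝ))) * (1 + 2 * ((P.tpN : ℝ) / (P.tpD : ℝ)) * Real.cos (y + ((P.q2z : ℝ) / (P.U : ℝ))))) x :=
    fun x y => hasDerivAt_bandFun_fst ((P.tpN : ℝ) / (P.tpD : ℝ)) ((P.muN : ℝ) / (P.muD : ℝ)) ((P.q1z : ℝ) / (P.U : ℝ)) ((P.q2z : ℝ) / (P.U : ℝ)) y x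
  have hgy : ∀ x y, HasDerivAt (fun s => g x s) (2 * Real.sin (y + ((P.q2z : ℝ) / (P.U : ℝ))) * (1 + 2 * ((P.tpN : ℝ) / (P.tpD : ℝ)) * Real.cos (x + ((P.q1z : ℝ) / (P.U : ℝ))))) y :=
    fun x y => hasDerivAt_bandFun_snd ((P.tpN : ℝ) / (P.tpD : ℝ)) ((P.muN : ℝ) / (P.muD : ℝ)) ((P.q1z : ℝ) / (P.U : ℝ)) ((P.q2z : ℝ) / (P.U : ℝ)) x y
  -- continuity ⇒ minimiser
  have hcont : Continuous fun p : ℝ × ℝ => |f p.1 p.2| + |g p.1 p.2| := by rw [hf, hgd]; fun_prop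
  obtain ⟨x', hx', y', hy', hmin⟩ := exists_isMinOn_rect (F := fun x y => |f x y| + |g x y|) hcont hab' hcd'
  refine ⟨x', hx', y', hy', fun x hx y hy => ?_⟩
  rw [← hfe, ← hge]
  have hLpos : (0 : ℝ) < (((2 * 10 ^ 4 * (D + cdivZ (2 * |P.tpN| * D) P.tpD)) : ℤ) : ℝ) / (10 ^ 4 * 2 ^ 40) :=
    div_pos (by exact_mod_cast P.Lmax_pos htpD) (by positivity)
  subst hC
  refine sum_abs_ge_of_isMinOn (f := f) (g := g) hfx hfy hgx hgy hLpos ?_ ?_ hx' hy' hmin hx hy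
  · -- the determinant bound at mixed points
    intro x₁ hx₁ y₁ hy₁ x₂ hx₂ y₂ hy₂ x₃ hx₃ y₃ hy₃ x₄ hx₄ y₄ hy₄
    have eA := P.tip_dx_e1_mem hP hin hdx h1 h2 hg hx₁.1 hx₁.2 hy₁.1 hy₁.2
    have eB := P.tip_dy_e1_mem hP hin hdy h3 h4 hg hx₂.1 hx₂.2 hy₂.1 hy₂.2
    have eC := P.tip_dx_e2_mem hP hin hdx' h5 h6 hg hx₃.1 hx₃.2 hy₃.1 hy₃.2
    have eD := P.tip_dy_e2_mem hP hin hdy' h7 h8 hg hx₄.1 hx₄.2 hy₄.1 hy₄.2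
    simp only [add_zero]
    refine det_unscale (det_ge_J0 _ _ _ _ eA.1 eA.2 eB.1 eB.2 eC.1 eC.2 eD.1 eD.2)
  · -- all partials ≤ Lmax / c
    intro x hx y hy
    simp only [add_zero]
    exact ⟨abs_le_Lmax_unscale (P.tip_partial_abs_le_Lmax hP x y), abs_le_Lmax_unscale (P.tip_partial_abs_le_Lmax hP y x),
      abs_le_Lmax_unscale (P.tip_partial_abs_le_Lmax hP _ _), abs_le_Lmax_unscale (P.tip_partial_abs_le_Lmax hP _ _)⟩

end Variants

end Summit.HubbardSuperconductivity.HubbardSuperconductivity.Theorems.KlLindhardEnclosure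

end
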